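import Summits.BirchSwinnertonDyer.BirchSwinnertonDyer.Theorems.KolyvaginRankRigidityAtTwoRegularRefillLagrangianPair
import HarnessLib

/-!
# Crux U1 `KolyvaginBoundedDefectAtTwo` (stmt-BirchSwinnertonDyer-28083), LINE 17 `regular_core_rigidity` v3,
# stub S1b `stub_nearCoreExistenceAtTwo` — refill at a regular prime, file 2/2: the REFILL LAW
# `2 · ann_{H_tr}(A) ⊆ X ∩ H_tr` for a Lagrangian `X` meeting `H_f` in a co-cyclic `A` (pure finite-group algebra)

Width seat `bsd-line-krr2-p2` g13 (ONE READER on S1b, re-key (280)(c)); `--supports stmt-BirchSwinnertonDyer-28083`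
(helper). THEOREMS ONLY, PURE ALGEBRA: nothing here proves S1b, U1, a rung or BSD. BSD is NOT proved.

## What is proved (hypotheses of file 1/2 `…RegularRefillLagrangianPair`: `L` finite `n`-torsion, `b` symmetric and
## non-degenerate, `L = H_f ⊕ H_tr` with both summands isotropic; plus `X` isotropic with `#X = #H_f`)

* `two_nsmul_mem_of_lagrangian_of_cyclic` (REFILL LAW): if moreover `H_f = (X ∩ H_f) + ℤe` for some `e ∈ H_f` (the cut
  `A = X ∩ H_f` is CO-CYCLIC — at a regular Kolyvagin prime: the pure-sign cut `A = (1+h)H_f`, `H_f/A ≅ ℤ/2^M`), then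
  `2t ∈ X` for every `t ∈ ann_{H_tr}(A)`. PROOF: `ann_{H_tr}(A)` embeds in `ℤ/n` by `⟨e, ·⟩` (perfectness), so it is
  cyclic, generator `t₀`; by the graph lemma `x₀ = k₀e + t₀ ∈ X`; isotropy `⟨x₀, x₀⟩ = 2k₀⟨e, t₀⟩ = 0` (here the
  SYMMETRY of the local Tate pairing on `H¹(K_λ, E[2^M])` — cup product anti-commutes, Weil pairing alternates — is what
  makes the diagonal term `2k₀⟨e, t₀⟩` rather than `0`); hence `⟨2k₀e, ann_{H_tr}(A)⟩ = 0`, `2k₀e ∈ A` (double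
  annihilator), `2t₀ = 2x₀ − 2k₀e ∈ X`.
* `natCard_le_two_mul_of_lagrangian_of_cyclic` (COUNTING FORM): `#H_f ≤ 2 · #(X ∩ H_f) · #(X ∩ H_tr)`. With
  `#H_f = 2^(2M)`, `#A = 2^M` and file 1's `#A · #B ≤ #X`: the refill `B = X ∩ H_tr` has `#B ∈ {2^(M−1), 2^M}` —
  refill exponent `a ≥ M − 1`, NOT «any `a ∈ [1, M]`» (report §3); the last bit (`a = M` vs `M − 1`) is genuinely
  global.
* `lozenge_refill` (WALK FORM, companion of `JET.Section6.lozenge_negSide`): for `loc : G →+ L` and `Rel ≤ G` (the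
  Selmer group relaxed at `λ`) with `loc(Rel)` isotropic of order `#H_f` and a co-cyclic cut,
  `S = Rel ⊓ loc⁻¹(H_f)` (`= H_{𝓕(n)}`), `S' = Rel ⊓ loc⁻¹(H_tr)` (`= H_{𝓕(nℓ)}`):
  `#S · #H_f ≤ 2 · #loc(S)² · #S'`; at a pure-sign regular step `#H_{𝓕(nℓ)} ≥ #H_{𝓕(n)} / 2`.
Consequence for S1b (memo `Cruxes/KolyvaginBoundedDefectAtTwo/S1-READER-g13.md`): the «2-adic refill law at regular
primes» is not a missing piece of print but a consequence of Poitou–Tate exactness + symmetry + regularity; what remains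
of S1b is the instantiation (`L = H¹(K_λ, E[2^M])` through a Weil datum: the tree's `localTatePairingZMod`,
`KolyvaginLowerBoundAtTwo.dualTransported_eq_of_hybrid`, `…TransverseLagrangianAtTwo`), a value-prescribing variant of
the Čebotarev engine, and the walk bookkeeping. Brute-force sanity check (session folder `work/lagr_check.py`): over
`(ℤ/2^M)⁴`, `M = 1, 2`, all 15 resp. 67 Lagrangians obey the law. References (locators only; no cited FACT is
declared): [cite: MazurRubin2004, Prop. 1.3.2, Thm. 2.3.4, §4.1] [cite: Howard2004HeegnerKolyvagin, Thm. 2.1.11]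
[cite: Jetchev2008, Lemma 5.2 (iii), §5.2, proof of Prop. 5.3] [cite: MilneADT2006, Ch. I §0 (0.19), Thm. 4.10].
Design: no definitions; `Type*`-polymorphic; `Nat.card`. Axioms: `propext`, `Classical.choice`, `Quot.sound`.
-/

set_option autoImplicit false
-- the Theorems namespace of this sub repeats the summit name by design (D-0017 nested layout)
set_option linter.dupNamespace false

noncomputable section

open scoped Classical
open Function

namespace Summit.BirchSwinnertonDyer.BirchSwinnertonDyer.Theorems.KolyvaginAtTwo.RegularRefill

open Summit.BirchSwinnertonDyer.Rank1Residual.JET.Section6 (card_eq_card_inf_ker_mul_card_map)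

variable {L : Type*} [AddCommGroup L]

section Lagrangian

variable {n : ℕ} (b : L →+ L →+ ZMod n)
  (hn : ∀ x : L, n • x = 0) (hsymm : ∀ x y, b x y = b y x)
  {Hf Htr : AddSubgroup L} (hdisj : Hf ⊓ Htr = ⊥) (hcod : Hf ⊔ Htr = ⊤)
  (hHf : ∀ x ∈ Hf, ∀ y ∈ Hf, b x y = 0) (hHtr : ∀ x ∈ Htr, ∀ y ∈ Htr, b x y = 0)

/-! ### §1 The refill law -/

include hn hsymm hdisj hcod hHf hHtr in
/-- **REFILL LAW at a co-cyclic step.** `b` symmetric and non-degenerate on the finite `n`-torsion group `L`,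
`L = H_f ⊕ H_tr` with both summands isotropic, `X` isotropic with `#X = #H_f`, and `H_f = (X ∩ H_f) + ℤe` for some
`e ∈ H_f` (so `H_f/(X ∩ H_f)` is cyclic — at a regular Kolyvagin prime: `X ∩ H_f = (1+h)H_f`, a pure-sign cut). Then
`2t ∈ X` for every `t ∈ ann_{H_tr}(X ∩ H_f)`, i.e. `2 · ann_{H_tr}(A) ⊆ X ∩ H_tr`: the refill has index `≤ 2` in its
largest possible value. PROOF: by the graph lemma pick, for a generator `t₀` of the cyclic group
`ann_{H_tr}(A) ↪ ℤ/n` (embedded by `⟨e, ·⟩`), `x₀ = k₀e + t₀ ∈ X`; isotropy `⟨x₀, x₀⟩ = 2k₀⟨e, t₀⟩ = 0` gives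
`⟨2k₀e, ann_{H_tr}(A)⟩ = 0`, so `2k₀e ∈ A` by the double annihilator, hence `2t₀ = 2x₀ − 2k₀e ∈ X`. -/
theorem two_nsmul_mem_of_lagrangian_of_cyclic [Finite L] [NeZero n] (hinj : Injective b) (X : AddSubgroup L)
    (hX : ∀ x ∈ X, ∀ y ∈ X, b x y = 0) (hcard : Nat.card X = Nat.card Hf)
    {e : L} (he : e ∈ Hf) (hcyc : ∀ f ∈ Hf, ∃ k : ℤ, f - k • e ∈ X)
    {t : L} (ht : t ∈ (Htr ⊓ ⨅ a ∈ X ⊓ Hf, (b a).ker : AddSubgroup L)) :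
    2 • t ∈ X := by
  set A : AddSubgroup L := X ⊓ Hf with hAdef
  set C : AddSubgroup L := Htr ⊓ ⨅ a ∈ A, (b a).ker with hC
  -- Step 1: each `s ∈ C` has a lift `k • e + s ∈ X`
  have hlift : ∀ s ∈ C, ∃ k : ℤ, k • e + s ∈ X := by
    intro s hs
    obtain ⟨x, hx, hxs⟩ := exists_mem_sub_mem_of_lagrangian b hn hsymm hdisj hcod hHf hHtr hinj X hX hcard hs
    obtain ⟨k, hk⟩ := hcyc (x - s) hxs
    refine ⟨k, ?_⟩
    have : k • e + s = x - (x - s - k • e) := by abel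
    rw [this]
    exact X.sub_mem hx hk
  -- Step 2: `χ = ⟨e, ·⟩` is injective on `C`, so `C` is cyclic
  have hχinj : ∀ s ∈ C, b e s = 0 → s = 0 := by
    intro s hs hes
    have hsT : s ∈ Htr := (AddSubgroup.mem_inf.mp hs).1
    refine eq_zero_of_mem_of_forall_mem' b hsymm hcod hHtr hinj hsT fun f hf => ?_
    obtain ⟨k, hk⟩ := hcyc f hf
    have ha : f - k • e ∈ A := AddSubgroup.mem_inf.mpr ⟨hk, Hf.sub_mem hf (Hf.zsmul_mem he k)⟩
    have h1 : b (f - k • e) s = 0 := ((mem_inf_iInf_ker_iff b Htr A s).mp hs).2 _ ha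
    rw [map_sub, map_zsmul, AddMonoidHom.sub_apply, AddMonoidHom.zsmul_apply, hes, smul_zero, sub_zero] at h1
    exact h1
  set χ : C →+ ZMod n := (b e).comp C.subtype with hχ
  have hχi : Injective χ := by
    intro s s' hss'
    have h0 : b e ((s : L) - s') = 0 := by
      rw [map_sub]
      exact sub_eq_zero.mpr hss'
    exact Subtype.ext (sub_eq_zero.mp (hχinj _ (C.sub_mem s.2 s'.2) h0))
  haveI : IsAddCyclic C := isAddCyclic_of_injective χ hχi
  obtain ⟨g, hg⟩ := exists_zsmul_surjective C
  -- Step 3: the generator's lift and the isotropy relation `2 k₀ ⟨e, g⟩ = 0`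
  obtain ⟨k₀, hk₀⟩ := hlift g g.2
  have hiso : (2 * k₀ : ℤ) • b e g = 0 := by
    have h := hX _ hk₀ _ hk₀
    have hee : b e e = 0 := hHf e he e he
    have hgg : b (g : L) g = 0 := hHtr g (AddSubgroup.mem_inf.mp g.2).1 g (AddSubgroup.mem_inf.mp g.2).1
    simp only [map_add, map_zsmul, AddMonoidHom.add_apply, AddMonoidHom.zsmul_apply, hee, hgg,
      hsymm (g : L) e, smul_zero, zero_add, add_zero] at h
    rw [two_mul, add_smul]
    exact h
  -- Step 4: `2k₀ • e ∈ A` by the double annihilator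
  have h2ke : (2 * k₀ : ℤ) • e ∈ A := by
    rw [← inf_ann_ann_eq b hn hsymm hcod hHf hHtr hinj A inf_le_right, mem_inf_iInf_ker_iff]
    refine ⟨Hf.zsmul_mem he _, fun s hs => ?_⟩
    obtain ⟨m, hm⟩ := hg ⟨s, hs⟩
    have hm' : m • g = ⟨s, hs⟩ := hm
    have hs' : (s : L) = m • (g : L) := by
      have h := congrArg Subtype.val hm'
      simp only [AddSubgroupClass.coe_zsmul] at h
      exact h.symm
    rw [hsymm, hs']
    simp only [map_zsmul, AddMonoidHom.zsmul_apply]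
    rw [hiso, smul_zero]
  -- Step 5: `2 • g ∈ X`, then `2 • t ∈ X` for `t = m • g`
  have h2g : (2 : ℤ) • (g : L) ∈ X := by
    have h2x : (2 : ℤ) • (k₀ • e + (g : L)) ∈ X := X.zsmul_mem hk₀ 2
    rw [smul_add, smul_smul] at h2x
    have := X.sub_mem h2x (AddSubgroup.mem_inf.mp h2ke).1
    rwa [add_sub_cancel_left] at this
  obtain ⟨m, hm⟩ := hg ⟨t, ht⟩
  have hm' : m • g = ⟨t, ht⟩ := hm
  have ht' : t = m • (g : L) := by
    have h := congrArg Subtype.val hm'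
    simp only [AddSubgroupClass.coe_zsmul] at h
    exact h.symm
  have h2 : (2 : ℕ) • t = m • ((2 : ℤ) • (g : L)) := by
    rw [ht', smul_comm, ← natCast_zsmul]
    norm_num
  rw [h2]
  exact X.zsmul_mem h2g m

/-! ### §2 Counting form -/

include hn hsymm hdisj hcod hHf hHtr in
/-- **REFILL LAW, COUNTING FORM: `#H_f ≤ 2 · #(X ∩ H_f) · #(X ∩ H_tr)`.** From `two_nsmul_mem_of_lagrangian_of_cyclic`:
`2 · ann_{H_tr}(A) ⊆ X ∩ H_tr`, and doubling on the cyclic group `ann_{H_tr}(A)` has kernel of order `≤ 2`, so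
`#ann_{H_tr}(A) ≤ 2 · #(X ∩ H_tr)`; multiply by `#A` and use `#ann_{H_tr}(A) · #A = #H_tr = #H_f`. At a pure-sign
regular step (`#H_f = 2^(2M)`, `#A = 2^M`): `#(X ∩ H_tr) ≥ 2^(M−1)`, i.e. refill exponent `a ≥ M − 1`. -/
theorem natCard_le_two_mul_of_lagrangian_of_cyclic [Finite L] [NeZero n] (hinj : Injective b) (X : AddSubgroup L)
    (hX : ∀ x ∈ X, ∀ y ∈ X, b x y = 0) (hcard : Nat.card X = Nat.card Hf)
    {e : L} (he : e ∈ Hf) (hcyc : ∀ f ∈ Hf, ∃ k : ℤ, f - k • e ∈ X) :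
    Nat.card Hf ≤ 2 * Nat.card ↥(X ⊓ Hf) * Nat.card ↥(X ⊓ Htr) := by
  set A : AddSubgroup L := X ⊓ Hf with hAdef
  set C : AddSubgroup L := Htr ⊓ ⨅ a ∈ A, (b a).ker with hC
  -- doubling on `C`
  set δ : L →+ L := nsmulAddMonoidHom 2 with hδ
  have hδ_apply : ∀ x, δ x = 2 • x := fun x => rfl
  have hCmap : C.map δ ≤ X ⊓ Htr := by
    rintro _ ⟨s, hs, rfl⟩
    rw [hδ_apply]
    exact AddSubgroup.mem_inf.mpr
      ⟨two_nsmul_mem_of_lagrangian_of_cyclic b hn hsymm hdisj hcod hHf hHtr hinj X hX hcard he hcyc hs,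
        Htr.nsmul_mem (AddSubgroup.mem_inf.mp hs).1 2⟩
  -- the kernel of doubling on `C` has order `≤ 2` (`C` embeds in `ℤ/n` by `⟨e, ·⟩`, so `C ∩ ker δ` is cyclic killed by 2)
  have hχinj : ∀ s ∈ C, b e s = 0 → s = 0 := by
    intro s hs hes
    have hsT : s ∈ Htr := (AddSubgroup.mem_inf.mp hs).1
    refine eq_zero_of_mem_of_forall_mem' b hsymm hcod hHtr hinj hsT fun f hf => ?_
    obtain ⟨k, hk⟩ := hcyc f hf
    have ha : f - k • e ∈ A := AddSubgroup.mem_inf.mpr ⟨hk, Hf.sub_mem hf (Hf.zsmul_mem he k)⟩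
    have h1 : b (f - k • e) s = 0 := ((mem_inf_iInf_ker_iff b Htr A s).mp hs).2 _ ha
    rw [map_sub, map_zsmul, AddMonoidHom.sub_apply, AddMonoidHom.zsmul_apply, hes, smul_zero, sub_zero] at h1
    exact h1
  set D : AddSubgroup L := C ⊓ δ.ker with hD
  set χ : D →+ ZMod n := (b e).comp D.subtype with hχ
  have hχi : Injective χ := by
    intro s s' hss'
    have h0 : b e ((s : L) - s') = 0 := by
      rw [map_sub]
      exact sub_eq_zero.mpr hss'
    exact Subtype.ext (sub_eq_zero.mp
      (hχinj _ (C.sub_mem (AddSubgroup.mem_inf.mp s.2).1 (AddSubgroup.mem_inf.mp s'.2).1) h0))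
  haveI : IsAddCyclic D := isAddCyclic_of_injective χ hχi
  have hD2 : Nat.card D ≤ 2 := by
    obtain ⟨g, hg⟩ := IsAddCyclic.exists_ofOrder_eq_natCard (α := D)
    have h2g : 2 • g = 0 := by
      apply Subtype.ext
      have : (g : L) ∈ δ.ker := (AddSubgroup.mem_inf.mp g.2).2
      rw [AddMonoidHom.mem_ker, hδ_apply] at this
      rw [AddSubgroupClass.coe_nsmul, this]; rfl
    rw [← hg]
    exact Nat.le_of_dvd two_pos (addOrderOf_dvd_of_nsmul_eq_zero h2g)
  have hCc : Nat.card C = Nat.card D * Nat.card (C.map δ) := card_eq_card_inf_ker_mul_card_map δ C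
  have hCle : Nat.card C ≤ 2 * Nat.card ↥(X ⊓ Htr) := by
    rw [hCc]
    exact Nat.mul_le_mul hD2 (AddSubgroup.card_le_of_le hCmap)
  have hCA : Nat.card C * Nat.card A = Nat.card Htr :=
    natCard_ann_mul_natCard b hn hsymm hcod hHf hHtr hinj A inf_le_right
  have hfT : Nat.card Hf = Nat.card Htr := natCard_eq_of_lagrangian_pair b hn hsymm hcod hHf hHtr hinj
  calc Nat.card Hf = Nat.card C * Nat.card A := by rw [hfT, hCA]
    _ ≤ 2 * Nat.card ↥(X ⊓ Htr) * Nat.card A := Nat.mul_le_mul_right _ hCle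
    _ = 2 * Nat.card ↥(X ⊓ Hf) * Nat.card ↥(X ⊓ Htr) := by rw [hAdef]; ring

/-! ### §3 Walk form: one regular step `𝓕(n) → 𝓕(nℓ)` loses at most a factor 2 in size at a pure-sign cut -/

include hn hsymm hdisj hcod hHf hHtr in
/-- **LOZENGE REFILL INEQUALITY** (companion of `JET.Section6.lozenge_negSide`). For `loc : G →+ L`, `Rel ≤ G` (the
Selmer group relaxed at `λ`), `S = Rel ⊓ loc⁻¹(H_f)` (`= H_{𝓕(n)}`), `S' = Rel ⊓ loc⁻¹(H_tr)` (`= H_{𝓕(nℓ)}`), with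
`X = loc(Rel)` isotropic of order `#H_f` and `H_f = loc(S) + ℤe` (co-cyclic cut):
`#S · #H_f ≤ 2 · #loc(S)² · #S'`. With `#H_f = 2^(2M)`, `#loc(S) = 2^M` (pure-sign cut by a regular prime):
`#H_{𝓕(nℓ)} ≥ #H_{𝓕(n)} / 2`. -/
theorem lozenge_refill [Finite L] [NeZero n] (hinj : Injective b) {G : Type*} [AddCommGroup G] (loc : G →+ L)
    (Rel : AddSubgroup G)
    (hX : ∀ x ∈ Rel.map loc, ∀ y ∈ Rel.map loc, b x y = 0) (hcard : Nat.card ↥(Rel.map loc) = Nat.card Hf)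
    {e : L} (he : e ∈ Hf) (hcyc : ∀ f ∈ Hf, ∃ k : ℤ, f - k • e ∈ Rel.map loc) :
    Nat.card ↥(Rel ⊓ Hf.comap loc) * Nat.card Hf ≤
      2 * Nat.card ↥((Rel ⊓ Hf.comap loc).map loc) ^ 2 * Nat.card ↥(Rel ⊓ Htr.comap loc) := by
  set X : AddSubgroup L := Rel.map loc with hXdef
  set S : AddSubgroup G := Rel ⊓ Hf.comap loc with hS
  set S' : AddSubgroup G := Rel ⊓ Htr.comap loc with hS'
  -- images: `loc(S) = X ∩ Hf`, `loc(S') = X ∩ Htr`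
  have himS : S.map loc = X ⊓ Hf := by
    ext y
    constructor
    · rintro ⟨s, hs, rfl⟩
      exact AddSubgroup.mem_inf.mpr ⟨⟨s, (AddSubgroup.mem_inf.mp hs).1, rfl⟩,
        AddSubgroup.mem_comap.mp (AddSubgroup.mem_inf.mp hs).2⟩
    · rintro ⟨⟨s, hs, rfl⟩, hy⟩
      exact ⟨s, AddSubgroup.mem_inf.mpr ⟨hs, AddSubgroup.mem_comap.mpr hy⟩, rfl⟩
  have himS' : S'.map loc = X ⊓ Htr := by
    ext y
    constructor
    · rintro ⟨s, hs, rfl⟩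
      exact AddSubgroup.mem_inf.mpr ⟨⟨s, (AddSubgroup.mem_inf.mp hs).1, rfl⟩,
        AddSubgroup.mem_comap.mp (AddSubgroup.mem_inf.mp hs).2⟩
    · rintro ⟨⟨s, hs, rfl⟩, hy⟩
      exact ⟨s, AddSubgroup.mem_inf.mpr ⟨hs, AddSubgroup.mem_comap.mpr hy⟩, rfl⟩
  -- common kernel part `S₀ = Rel ⊓ ker loc = S ⊓ ker loc = S' ⊓ ker loc`
  have hk : S ⊓ loc.ker = S' ⊓ loc.ker := by
    ext s
    simp only [hS, hS', AddSubgroup.mem_inf, AddSubgroup.mem_comap, AddMonoidHom.mem_ker]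
    constructor
    · rintro ⟨⟨hs, -⟩, h0⟩; exact ⟨⟨hs, by rw [h0]; exact Htr.zero_mem⟩, h0⟩
    · rintro ⟨⟨hs, -⟩, h0⟩; exact ⟨⟨hs, by rw [h0]; exact Hf.zero_mem⟩, h0⟩
  have hSc : Nat.card S = Nat.card ↥(S ⊓ loc.ker) * Nat.card ↥(X ⊓ Hf) := by
    rw [← himS]; exact card_eq_card_inf_ker_mul_card_map loc S
  have hS'c : Nat.card S' = Nat.card ↥(S' ⊓ loc.ker) * Nat.card ↥(X ⊓ Htr) := by
    rw [← himS']; exact card_eq_card_inf_ker_mul_card_map loc S'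
  have hmain := natCard_le_two_mul_of_lagrangian_of_cyclic b hn hsymm hdisj hcod hHf hHtr hinj X hX hcard he hcyc
  rw [himS]
  calc Nat.card S * Nat.card Hf
      ≤ Nat.card S * (2 * Nat.card ↥(X ⊓ Hf) * Nat.card ↥(X ⊓ Htr)) := Nat.mul_le_mul_left _ hmain
    _ = 2 * Nat.card ↥(X ⊓ Hf) ^ 2 * (Nat.card ↥(S' ⊓ loc.ker) * Nat.card ↥(X ⊓ Htr)) := by
        rw [hSc, hk]; ring
    _ = 2 * Nat.card ↥(X ⊓ Hf) ^ 2 * Nat.card S' := by rw [← hS'c]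

end Lagrangian

end Summit.BirchSwinnertonDyer.BirchSwinnertonDyer.Theorems.KolyvaginAtTwo.RegularRefill

end
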